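import Literature.Analysis.FluidPDE.LittlewoodPaleyFields
import Literature.Analysis.FluidPDE.CheskidovShvydkoyAssembly
import Literature.Analysis.FluidPDE.NSVorticityBKMEnergy
import Literature.Analysis.FluidPDE.ElgindiBlowup
import Literature.Analysis.FunctionSpaces.LittlewoodPaleyConvergenceProofs
import HarnessLib

/-!
# Fluid computer — the LITTLEWOOD–PALEY SUM BRIDGE for the vorticity sup, and the block sup-norms of a
# classical solution as functions of time (support file of `SummedOccupationFloor`)

HONEST FRAMING (cell `pub-fluidc`, verbatim): *low prior, high value-of-information experiment on Tao's
machine paradigm; NOT a claim that NS blows up.* Theorem side of the cell; nothing here is evidence of blow-up.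

`VorticityOccupationWindow` (BKM in every terminal window, `ν ≥ 0`) reads its theorem in cascade words through a
dictionary it marks as HEDGED: "`‖ω‖_∞ ≲ Σ_n k_n U_n` over the active levels". This file PROVES that dictionary
from the tree's Littlewood–Paley theory, with `U_j = ‖Δ̇_j u‖_{L^∞}` the level sup-amplitudes of the cell's floors
(`LevelReynoldsFloor`, `LevelOccupationFloor`: `blockFn j`, `k_j = 2^j`):

* `exists_eLpNorm_fderiv_apply_le_tsum` — for a smooth `L²` field `v : ℝ³ → ℝ³` (all derivatives bounded and square
  integrable, tree `IsSmoothL2Field`) and a direction `m`: `‖∂_m v‖_{L^∞} ≤ C ‖m‖ Σ_{j ∈ ℤ} 2^j ‖Δ̇_j v‖_{L^∞}` —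
  the distribution of `∂_m v ∈ L²` is in `𝓢'_h` (tree `tendsto_lowFreqCutoff_of_memLp_two_holds`, BCD Def. 1.26), so
  `‖∂_m v‖_∞ ≤ Σ_j ‖Δ̇_j ∂_m v‖_∞` (tree `eLpNormDistrib_le_tsum_lpBlock`, BCD Prop. 2.12), and Bernstein
  `‖∂_m Δ̇_j v‖_∞ ≤ C 2^j ‖m‖ ‖Δ̇_j v‖_∞` (tree `exists_eLpNormDistrib_lineDeriv_lpBlock_le`, BCD Lemma 2.1);
* `exists_iSup_curl_le_tsum` — **the bridge**: `sup_x ‖curl v (x)‖ ≤ C Σ_{j ∈ ℤ} 2^j ‖Δ̇_j v‖_{L^∞}`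
  (`‖curl v‖ ≤ 4‖Dv‖ ≤ 4 Σ_i ‖∂_i v‖`);
* the slices of a classical solution on `ℝ³ × [0, T)` in the Beale–Kato–Majda class on every `[0, T'']`, `T'' < T`,
  are smooth `L²` fields (`isSmoothL2Field_slice`), their energy does not increase (`eLpNorm_two_slice_le`, `ν ≥ 0`,
  tree `IsClassicalNSSolutionOn.bkm_energy_le`), the blocks `t ↦ (Δ̇_j u(t))(x)` are continuous in time on closed
  sub-slabs (`continuousOn_blockFn_slice`, dominated convergence) and `t ↦ ‖Δ̇_j u(t)‖_{L^∞}` is a.e.-measurable on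
  every window `(t₀, T)` (`aemeasurable_blockSup`: sup over a countable dense set) — the Tonelli input of
  `SummedOccupationFloor`.

Not here: the floor itself (`SummedOccupationFloor`); torus versions; any statement about sharp spectral bands (the
atlas's band sups are not Littlewood–Paley blocks — RULING R33 / `BandSupOvershoot`). 0 sorry; no new definitions or
named facts.

## References

* H. Bahouri, J.-Y. Chemin, R. Danchin, *Fourier Analysis and Nonlinear PDE*, Springer 2011, Def. 1.26, Lemma 2.1,
  Prop. 2.12. [BahouriCheminDanchin2011]
* A. J. Majda, A. L. Bertozzi, *Vorticity and Incompressible Flow*, CUP 2002, §3.1.1 Prop. 3.1. [MajdaBertozzi2002]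
-/

noncomputable section

open MeasureTheory Set Function Filter Topology
open scoped ENNReal NNReal LineDeriv SchwartzMap
open Literature.Analysis.FluidPDE Literature.Analysis.FunctionSpaces

namespace Summit.NavierStokesRegularity.FluidComputer.SummedOccupationBridge

/-! ## §1 The Littlewood–Paley sum bridge for the vorticity sup (pure analysis, no PDE) -/

/-- The operator norm of a linear map on `ℝ³` is at most the sum of the norms of the images of the
standard basis vectors: `‖L‖ ≤ ∑_i ‖L e_i‖`. [folklore] -/
theorem opNorm_le_sum_norm_apply_single {F : Type*} [NormedAddCommGroup F] [NormedSpace ℝ F]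
    (L : EuclideanSpace ℝ (Fin 3) →L[ℝ] F) : ‖L‖ ≤ ∑ i, ‖L (EuclideanSpace.single i 1)‖ := by
  refine ContinuousLinearMap.opNorm_le_bound _ (Finset.sum_nonneg fun i _ => norm_nonneg _)
    fun h => ?_
  have hh : h = ∑ i, h i • EuclideanSpace.single i (1 : ℝ) := by
    simpa using ((EuclideanSpace.basisFun (Fin 3) ℝ).sum_repr h).symm
  calc ‖L h‖ = ‖∑ i, h i • L (EuclideanSpace.single i 1)‖ := by
        conv_lhs => rw [hh]
        simp only [map_sum, map_smul]
    _ ≤ ∑ i, ‖h i • L (EuclideanSpace.single i 1)‖ := norm_sum_le _ _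
    _ ≤ ∑ i, ‖h‖ * ‖L (EuclideanSpace.single i 1)‖ := by
        refine Finset.sum_le_sum fun i _ => ?_
        rw [norm_smul]
        exact mul_le_mul_of_nonneg_right (by simpa using PiLp.norm_apply_le h i) (norm_nonneg _)
    _ = (∑ i, ‖L (EuclideanSpace.single i 1)‖) * ‖h‖ := by rw [← Finset.mul_sum, mul_comm]

/-- For a continuous field the `L^∞` norm is the supremum: `‖f‖_{L^∞} = sup_x ‖f x‖`
(Lebesgue measure charges every open set). [folklore] -/
theorem eLpNorm_top_eq_iSup_of_continuous {F : Type*} [NormedAddCommGroup F] {f : EuclideanSpace ℝ (Fin 3) → F}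
    (hf : Continuous f) : eLpNorm f ∞ volume = ⨆ x, ‖f x‖ₑ := by
  refine le_antisymm ?_ (iSup_le fun x => enorm_le_eLpNorm_top_of_continuous volume hf x)
  rw [eLpNorm_exponent_top]
  exact essSup_le_iSup

/-- For a continuous field and a dense set `D`, `‖f‖_{L^∞} = sup_{q ∈ D} ‖f q‖`. [folklore] -/
theorem eLpNorm_top_eq_iSup_dense_of_continuous {F : Type*} [NormedAddCommGroup F] {f : EuclideanSpace ℝ (Fin 3) → F}
    (hf : Continuous f) {D : Set (EuclideanSpace ℝ (Fin 3))} (hD : Dense D) :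
    eLpNorm f ∞ volume = ⨆ q : D, ‖f q‖ₑ := by
  refine le_antisymm ?_ (iSup_le fun q => enorm_le_eLpNorm_top_of_continuous volume hf q)
  rw [eLpNorm_top_eq_iSup_of_continuous hf]
  refine iSup_le fun y => ?_
  have hC : IsClosed {z | ‖f z‖ₑ ≤ ⨆ q : D, ‖f q‖ₑ} := isClosed_le hf.enorm continuous_const
  have hDC : D ⊆ {z | ‖f z‖ₑ ≤ ⨆ q : D, ‖f q‖ₑ} := fun z hz => le_iSup (fun q : D => ‖f q‖ₑ) ⟨z, hz⟩
  have hy : y ∈ closure D := by rw [hD.closure_eq]; exact mem_univ _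
  exact closure_minimal hDC hC hy

/-- **The LP-sum bridge for one derivative.** There is an absolute `C` such that for every smooth
`L²` field `v : ℝ³ → ℝ³` (all derivatives bounded and square integrable) and every direction `m`,
`‖∂_m v‖_{L^∞} ≤ C ‖m‖ ∑_{j ∈ ℤ} 2^j ‖Δ̇_j v‖_{L^∞}`: the distribution of `∂_m v ∈ L²` lies in `𝓢'_h`
(tree `tendsto_lowFreqCutoff_of_memLp_two_holds`), so `‖∂_m v‖_∞ ≤ ∑_j ‖Δ̇_j ∂_m v‖_∞`
(tree `eLpNormDistrib_le_tsum_lpBlock`, BCD Prop. 2.12), and `‖∂_m Δ̇_j v‖_∞ ≤ C 2^j ‖m‖ ‖Δ̇_j v‖_∞`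
(Bernstein, tree `exists_eLpNormDistrib_lineDeriv_lpBlock_le`, BCD Lemma 2.1).
[cite: BahouriCheminDanchin2011, Lemma 2.1 and Prop. 2.12] -/
theorem exists_eLpNorm_fderiv_apply_le_tsum :
    ∃ C : ℝ≥0, ∀ (v : EuclideanSpace ℝ (Fin 3) → EuclideanSpace ℝ (Fin 3)), IsSmoothL2Field v →
      ∀ m : EuclideanSpace ℝ (Fin 3),
      eLpNorm (fun x => fderiv ℝ v x m) ∞ volume ≤
        C * ‖m‖ₑ * ∑' j : ℤ, (2 : ℝ≥0∞) ^ j * eLpNorm (blockFn j v) ∞ volume := by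
  haveI : Fact (1 ≤ (∞ : ℝ≥0∞)) := ⟨le_top⟩
  obtain ⟨C, hC⟩ := exists_eLpNormDistrib_lineDeriv_lpBlock_le
    (E := EuclideanSpace ℝ (Fin 3)) (F := EuclideanSpace ℂ (Fin 3)) ∞
  refine ⟨C, fun v hv m => ?_⟩
  -- the distributions of `v` and of `∂_m v`
  have hv2 : MemLp v 2 volume := hv.memLp_two
  have hvm2 : MemLp (fun x => fderiv ℝ v x m) 2 volume := hv.memLp_fderiv_apply m
  set V : 𝓢'(EuclideanSpace ℝ (Fin 3), EuclideanSpace ℂ (Fin 3)) :=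
    Lp.toTemperedDistribution ((memLp_complexify_comp hv2).toLp _) with hVdef
  have hV : IsDistributionOf v V := isDistributionOf_toTemperedDistribution hv2
  have hW : IsDistributionOf (fun x => fderiv ℝ v x m) (∂_{m} V) :=
    hV.lineDeriv (hv.contDiff.of_le (mod_cast le_top)) hv2 m hvm2
  -- `‖∂_m v‖_∞` as a distributional norm
  have hvmtop : MemLp (fun x => fderiv ℝ v x m) ∞ volume :=
    memLp_top_of_hasBoundedDerivs (hv.fderiv_apply m).toHasBoundedDerivs
  have h1 : eLpNorm (fun x => fderiv ℝ v x m) ∞ volume = eLpNormDistrib ∞ (∂_{m} V) :=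
    (hW.eLpNormDistrib_eq hvmtop).symm
  -- LP reconstruction in `L^∞`
  have h0 : Tendsto (fun j : ℤ => lowFreqCutoff j (∂_{m} V)) atBot (𝓝 0) :=
    tendsto_lowFreqCutoff_of_memLp_two_holds hvm2 hW
  have h2 : eLpNormDistrib ∞ (∂_{m} V) ≤ ∑' j : ℤ, eLpNormDistrib ∞ (lpBlock j (∂_{m} V)) :=
    eLpNormDistrib_le_tsum_lpBlock _ h0
  -- Bernstein, block by block, and the dictionary back to function norms
  have h3 : ∀ j : ℤ, eLpNormDistrib ∞ (lpBlock j (∂_{m} V)) ≤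
      C * ‖m‖ₑ * ((2 : ℝ≥0∞) ^ j * eLpNorm (blockFn j v) ∞ volume) := fun j => by
    rw [lpBlock_lineDeriv_comm]
    refine (hC m j V).trans (le_of_eq ?_)
    rw [hV.eLpNormDistrib_top_lpBlock_eq hv2 j, ENNReal.ofReal_mul (zpow_nonneg (by norm_num) j),
      Literature.Analysis.FluidPDE.ofReal_two_zpow, ofReal_norm]
    ring
  calc eLpNorm (fun x => fderiv ℝ v x m) ∞ volume
      = eLpNormDistrib ∞ (∂_{m} V) := h1
    _ ≤ ∑' j : ℤ, eLpNormDistrib ∞ (lpBlock j (∂_{m} V)) := h2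
    _ ≤ ∑' j : ℤ, C * ‖m‖ₑ * ((2 : ℝ≥0∞) ^ j * eLpNorm (blockFn j v) ∞ volume) :=
        ENNReal.tsum_le_tsum h3
    _ = C * ‖m‖ₑ * ∑' j : ℤ, (2 : ℝ≥0∞) ^ j * eLpNorm (blockFn j v) ∞ volume :=
        ENNReal.tsum_mul_left

/-- **The LP-sum bridge for the vorticity** (the "hedged dictionary" `‖ω‖_∞ ≲ Σ_n k_n U_n` of
`VorticityOccupationWindow`, as a theorem): there is an absolute `C` such that for every smooth `L²`
field `v : ℝ³ → ℝ³`, `sup_x ‖curl v (x)‖ ≤ C ∑_{j ∈ ℤ} 2^j ‖Δ̇_j v‖_{L^∞}` (in `[0, ∞]`): pointwise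
`‖curl v‖ ≤ 4 ‖Dv‖ ≤ 4 ∑_i ‖∂_i v‖`, each `‖∂_i v (x)‖ ≤ ‖∂_i v‖_∞` (continuity), and
`exists_eLpNorm_fderiv_apply_le_tsum`. [cite: BahouriCheminDanchin2011, Lemma 2.1 and Prop. 2.12] -/
theorem exists_iSup_curl_le_tsum :
    ∃ C : ℝ≥0, ∀ (v : EuclideanSpace ℝ (Fin 3) → EuclideanSpace ℝ (Fin 3)), IsSmoothL2Field v →
      (⨆ x, ‖curl v x‖ₑ) ≤ C * ∑' j : ℤ, (2 : ℝ≥0∞) ^ j * eLpNorm (blockFn j v) ∞ volume := by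
  obtain ⟨C, hC⟩ := exists_eLpNorm_fderiv_apply_le_tsum
  refine ⟨4 * (3 * C), fun v hv => iSup_le fun x => ?_⟩
  set S : ℝ≥0∞ := ∑' j : ℤ, (2 : ℝ≥0∞) ^ j * eLpNorm (blockFn j v) ∞ volume with hS
  have hcont : ∀ i : Fin 3, Continuous fun y => fderiv ℝ v y (EuclideanSpace.single i 1) :=
    fun i => (hv.fderiv_apply _).continuous
  -- `‖∂_i v (x)‖ ≤ C · S`
  have hi : ∀ i : Fin 3, ‖fderiv ℝ v x (EuclideanSpace.single i 1)‖ₑ ≤ C * S := fun i => by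
    refine (enorm_le_eLpNorm_top_of_continuous volume (hcont i) x).trans ?_
    refine (hC v hv (EuclideanSpace.single i 1)).trans (le_of_eq ?_)
    have h1 : ‖EuclideanSpace.single i (1 : ℝ)‖ₑ = 1 := by
      rw [← ofReal_norm]; simp
    rw [hS, h1, mul_one]
  calc ‖curl v x‖ₑ = ENNReal.ofReal ‖curl v x‖ := (ofReal_norm _).symm
    _ ≤ ENNReal.ofReal (4 * ‖fderiv ℝ v x‖) := ENNReal.ofReal_le_ofReal (norm_curl_le_four_mul v x)
    _ = 4 * ‖fderiv ℝ v x‖ₑ := by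
        rw [ENNReal.ofReal_mul (by norm_num), ofReal_norm, ENNReal.ofReal_ofNat]
    _ ≤ 4 * ∑ i : Fin 3, ‖fderiv ℝ v x (EuclideanSpace.single i 1)‖ₑ := by
        gcongr
        rw [← ofReal_norm]
        refine (ENNReal.ofReal_le_ofReal (opNorm_le_sum_norm_apply_single _)).trans (le_of_eq ?_)
        rw [ENNReal.ofReal_sum_of_nonneg fun i _ => norm_nonneg _]
        exact Finset.sum_congr rfl fun i _ => ofReal_norm _
    _ ≤ 4 * ∑ _i : Fin 3, C * S := by gcongr with i; exact hi i
    _ = (4 * (3 * C) : ℝ≥0) * S := by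
        rw [Finset.sum_const, Finset.card_univ, Fintype.card_fin]; push_cast; ring

/-! ## §2 Slices of a classical solution in the BKM class; time measurability of the block sup-norms -/

/-- The slices `u t`, `t ∈ [0, T)`, of a classical solution on `ℝ³ × [0, T)` lying in the
Beale–Kato–Majda class on every `[0, T'']`, `T'' < T`, are smooth `L²` fields (all derivatives
bounded and square integrable; tree `isSmoothL2Field_of_sobolev`, Sobolev imbedding). [folklore] -/
theorem isSmoothL2Field_slice {ν T : ℝ} {u : ℝ → EuclideanSpace ℝ (Fin 3) → EuclideanSpace ℝ (Fin 3)}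
    {p : ℝ → EuclideanSpace ℝ (Fin 3) → ℝ}
    (hsol : IsClassicalNSSolutionOn (Ico 0 T) ν 0 u p)
    (hreg : ∀ T'' < T, HasBoundedSobolevNormsOn (Icc 0 T'') u) {t : ℝ} (ht : t ∈ Ico 0 T) :
    IsSmoothL2Field (u t) := by
  refine isSmoothL2Field_of_sobolev (hsol.contDiff_velocity ht) fun n => ?_
  obtain ⟨C, hC⟩ := hreg t ht.2 n
  exact (hC t ⟨ht.1, le_rfl⟩).trans_lt ENNReal.coe_lt_top

/-- **Energy decay in the BKM class up to the blow-up time** (`ν ≥ 0`): `‖u(t)‖_{L²} ≤ ‖u(0)‖_{L²}`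
for `t ∈ [0, T)` (the tree's energy inequality `IsClassicalNSSolutionOn.bkm_energy_le` on the slab
`[0, t]`; Majda–Bertozzi 2002, Prop. 3.1). [cite: MajdaBertozzi2002, §3.1.1 Prop. 3.1] -/
theorem eLpNorm_two_slice_le {ν : ℝ} (hν : 0 ≤ ν) {T : ℝ} {u : ℝ → EuclideanSpace ℝ (Fin 3) → EuclideanSpace ℝ (Fin 3)}
    {p : ℝ → EuclideanSpace ℝ (Fin 3) → ℝ}
    (hsol : IsClassicalNSSolutionOn (Ico 0 T) ν 0 u p)
    (hreg : ∀ T'' < T, HasBoundedSobolevNormsOn (Icc 0 T'') u) {t : ℝ} (ht : t ∈ Ico 0 T) :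
    eLpNorm (u t) 2 volume ≤ eLpNorm (u 0) 2 volume := by
  rcases ht.1.eq_or_lt with h0 | h0
  · rw [← h0]
  have h0T : (0 : ℝ) ∈ Ico 0 T := ⟨le_rfl, h0.trans ht.2⟩
  have hsol' : IsClassicalNSSolutionOn (Icc 0 t) ν 0 u p :=
    hsol.mono (Icc_subset_Ico_right ht.2) (uniqueDiffOn_Icc h0)
  have hE : ∫ x, ‖u t x‖ ^ 2 ≤ ∫ x, ‖u 0 x‖ ^ 2 := hsol'.bkm_energy_le hν h0 (hreg t ht.2) ⟨ht.1, le_rfl⟩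
  have hft : MemLp (u t) 2 volume := (isSmoothL2Field_slice hsol hreg ht).memLp_two
  have hf0 : MemLp (u 0) 2 volume := (isSmoothL2Field_slice hsol hreg h0T).memLp_two
  rw [hft.eLpNorm_eq_integral_rpow_norm two_ne_zero ENNReal.ofNat_ne_top,
    hf0.eLpNorm_eq_integral_rpow_norm two_ne_zero ENNReal.ofNat_ne_top]
  simp only [ENNReal.toReal_ofNat, Real.rpow_two]
  exact ENNReal.ofReal_le_ofReal
    (Real.rpow_le_rpow (integral_nonneg fun x => sq_nonneg _) hE (by norm_num))

/-- **Time continuity of the blocks at a point, on closed sub-slabs.** For a classical solution on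
`[0, T)` in the BKM class on `[0, T'']`, `T'' < T`, and every level `j` and point `x`, the map
`t ↦ (Δ̇_j u(t))(x) = ∫ K_j(s) u(t, x - s) ds` is continuous on `[0, T'']` (dominated convergence:
`u` is jointly continuous and bounded on the slab, `K_j ∈ L¹`). [folklore] -/
theorem continuousOn_blockFn_slice {ν T : ℝ} {u : ℝ → EuclideanSpace ℝ (Fin 3) → EuclideanSpace ℝ (Fin 3)}
    {p : ℝ → EuclideanSpace ℝ (Fin 3) → ℝ}
    (hsol : IsClassicalNSSolutionOn (Ico 0 T) ν 0 u p)
    (hreg : ∀ T'' < T, HasBoundedSobolevNormsOn (Icc 0 T'') u) {T'' : ℝ} (hT'' : T'' < T)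
    (j : ℤ) (x : EuclideanSpace ℝ (Fin 3)) : ContinuousOn (fun t => blockFn j (u t) x) (Icc 0 T'') := by
  have hsub : Icc 0 T'' ⊆ Ico 0 T := fun t ht => ⟨ht.1, ht.2.trans_lt hT''⟩
  have hu : ∀ t ∈ Icc 0 T'', ContDiff ℝ ((⊤ : ℕ∞) : WithTop ℕ∞) (u t) := fun t ht =>
    hsol.contDiff_velocity (hsub ht)
  obtain ⟨B, -, hB⟩ := exists_forall_norm_iteratedFDeriv_le_bkmClass hu (hreg T'' hT'') 0
  have hB' : ∀ t ∈ Icc 0 T'', ∀ y, ‖u t y‖ ≤ B := fun t ht y => by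
    simpa [norm_iteratedFDeriv_zero] using hB t ht y
  have heq : (fun t => blockFn j (u t) x) = fun t => ∫ s, blockKernel (EuclideanSpace ℝ (Fin 3)) j s • u t (x - s) := by
    funext t; exact blockFn_apply j (u t) x
  rw [heq]
  refine continuousOn_of_dominated (bound := fun s => ‖blockKernel (EuclideanSpace ℝ (Fin 3)) j s‖ * B) ?_ ?_ ?_ ?_
  · intro t ht
    exact ((continuous_blockKernel j).smul
      ((hu t ht).continuous.comp (continuous_const.sub continuous_id))).aestronglyMeasurable
  · intro t ht
    refine Eventually.of_forall fun s => ?_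
    rw [norm_smul]
    exact mul_le_mul_of_nonneg_left (hB' t ht _) (norm_nonneg _)
  · exact (integrable_blockKernel j).norm.mul_const B
  · refine Eventually.of_forall fun s => ?_
    have hc : ContinuousOn (uncurry u) (Ico 0 T ×ˢ univ) := hsol.smooth_velocity.continuousOn
    have hm : MapsTo (fun t : ℝ => (t, x - s)) (Icc 0 T'') (Ico 0 T ×ˢ univ) :=
      fun t ht => ⟨hsub ht, mem_univ _⟩
    have h1 : ContinuousOn (fun t : ℝ => u t (x - s)) (Icc 0 T'') :=
      hc.comp (continuousOn_id.prodMk continuousOn_const) hm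
    exact h1.const_smul (blockKernel (EuclideanSpace ℝ (Fin 3)) j s)

/-- **Time measurability of the block sup-norms** `t ↦ ‖Δ̇_j u(t)‖_{L^∞}` on every window
`(t₀, T)`, `t₀ ≥ 0`: the sup over a countable dense set of points of functions continuous in `t`
(`continuousOn_blockFn_slice`; the blocks of the smooth slices are continuous in `x`). [folklore] -/
theorem aemeasurable_blockSup {ν T : ℝ} {u : ℝ → EuclideanSpace ℝ (Fin 3) → EuclideanSpace ℝ (Fin 3)}
    {p : ℝ → EuclideanSpace ℝ (Fin 3) → ℝ}
    (hsol : IsClassicalNSSolutionOn (Ico 0 T) ν 0 u p)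
    (hreg : ∀ T'' < T, HasBoundedSobolevNormsOn (Icc 0 T'') u) (j : ℤ) {t₀ : ℝ} (ht₀ : 0 ≤ t₀) :
    AEMeasurable (fun t => eLpNorm (blockFn j (u t)) ∞ volume) (volume.restrict (Ioo t₀ T)) := by
  obtain ⟨D, hDc, hDd⟩ := TopologicalSpace.exists_countable_dense (EuclideanSpace ℝ (Fin 3))
  haveI : Countable D := hDc.to_subtype
  have hcont : ∀ q : EuclideanSpace ℝ (Fin 3), ContinuousOn (fun t => blockFn j (u t) q) (Ioo t₀ T) := by
    intro q t ht
    have hT'' : (t + T) / 2 < T := by linarith [ht.2]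
    have htT'' : t < (t + T) / 2 := by linarith [ht.2]
    have h := continuousOn_blockFn_slice hsol hreg hT'' j q
    exact (h.continuousAt (Icc_mem_nhds (ht₀.trans_lt ht.1) htT'')).continuousWithinAt
  have hq : ∀ q : D, AEMeasurable (fun t => ‖blockFn j (u t) (q : EuclideanSpace ℝ (Fin 3))‖ₑ)
      (volume.restrict (Ioo t₀ T)) := fun q => (hcont q).enorm.aemeasurable measurableSet_Ioo
  have hsup : AEMeasurable (fun t => ⨆ q : D, ‖blockFn j (u t) (q : EuclideanSpace ℝ (Fin 3))‖ₑ)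
      (volume.restrict (Ioo t₀ T)) := AEMeasurable.iSup hq
  refine hsup.congr ?_
  rw [EventuallyEq, ae_restrict_iff' measurableSet_Ioo]
  refine Eventually.of_forall fun t ht => ?_
  have hc : Continuous (blockFn j (u t)) :=
    ((isSmoothL2Field_slice hsol hreg ⟨ht₀.trans ht.1.le, ht.2⟩).blockFn j).continuous
  exact (eLpNorm_top_eq_iSup_dense_of_continuous hc hDd).symm

end Summit.NavierStokesRegularity.FluidComputer.SummedOccupationBridge

end
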